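import Summits.QuantumFields.YangMills.Theorems.FluctuationComparisonRegPrIntLS2BetaSlowDataNets
import Summits.QuantumFields.YangMills.Theorems.FluctuationComparisonRegPrIntLS2BetaAntipodalConeCentre
import HarnessLib

/-!
# S2β · D-GUARD ∕ (BG∞) — (B3-I) «A CONE CENTRE FOR TWO SLOW FACES» — the first brick of FILL₁ (the LAST filling letter of ✓`hSec_of_fillings`)

Cell `ym3-torus` (YM ladder rung R3 = continuum `SU(2)` Yang–Mills on the three-torus at fixed lattice data — a RUNG: NOT d = 4, NOT infinite volume,
NOT a mass gap, NOT Clay).  Width seat `ym-ust-20520-w3` (gen 29) = LEAD-20520 on crux `stmt-QuantumFields-20520` (`FluctuationComparisonRegPrIntL`;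
registry `Lines/semiclassical_s2beta.lean` v11 UNTOUCHED, 0∕5); `--kind proof --supports stmt-QuantumFields-20520 --as helper`, count-neutral,
DEFINITION-FREE (0 `def`, 0 `instance`, 0 `notation`, 0 `sorry`, default heartbeats).

WHY.  BY KERNEL `hBG` ⟸ FILL₁ alone ((ASSEMBLY-F) `hBG_of_fillings`: FILL₂ = ✓`fill_tube`, FILL₃ = ✓`fill3`).  FILL₁ is the stage-1 letter: a datum prescribed
on the two opposite `α`-faces of a box, `ε`-slow along the bonds inside those faces, extends to an `(A∕ρ)`-slow section.  The extension of record is (L-I)'s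
two-leg filling through a centre `m` (✓`dist1_stageI_axial_le` ∕ ✓`dist1_stageI_transverse_le`), whose transverse letter asks that BOTH face data lie in the cap
`‖logVec (m⁻¹·φ)‖ ≤ π − r`.  The two faces are NOT connected to each other inside the odd-face set, so no path argument joins them; but px5 g24's packing road
((B3′) ✓`exists_tubeCentre`) never used connectivity between faces: each face is a slow `(nβ+1) × (nγ+1)` grid, ✓`exists_patch_of_grid` nets it, and
✓`exists_coneCentre_of_patched` returns a centre as soon as the total cap count is `< 1`.  THIS FILE is that proof with the two `β`-faces deleted — the
two-face twin of ✓`exists_tubeCentre`, same constants per face.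

WHAT IS PROVED (sorry-free).
* `card_twoFaces` — the cardinality of `F ⊕ F`, `F := Fin A × Fin B`, in `ℝ`.
* ★★ `exists_twoFaceCentre (nα nβ nγ m) (hm : 1 ≤ m) (ψ : ℕ × ℕ × ℕ → SU2) (hδ) (hr0) (hrπ : 3r∕2 ≤ π) (hB) (hC) (hrad : π∕2·((2(m−1))·δ) ≤ r∕2)
  (hcard : (2·((nβ∕m+1)·(nγ∕m+1)))·(2∕(3π)·(3r∕2)³) < 1) :
  ∃ a, ∀ i k l, (i = 0 ∨ i = nα) → k ≤ nβ → l ≤ nγ → ‖logVec (su2Quat (a⁻¹·ψ (i, k, l)))‖ ≤ π − r`.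

HONEST SCOPE.  Composition of landed bricks (px5 g24's nets and cone centre); no lattice, no gauge field; nothing of Bałaban's renormalisation-group analysis is
asserted or proved ([Balaban1985RegularSpaces] Thm 2 p.83 — local small gauges — is the consumer's context only).  FILL₁ itself is NOT proved here (it still needs
the site-level two-face section over (L-I) and the numerics, the twins of ✓`tube_section` ∕ ✓`fill_tube`); `hBG` ∕ (BG∞) ∕ `hsupp⁺` ∕ the floored `hsupp` letters
remain UNPROVED; GAP♯∘ (registry UNTOUCHED), the five registered stubs (0∕5), S2β, 20520, 19936, 19200, `YM3TorusSU2` are NOT proved; no registered stub is closed;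
rung R3 — NOT d = 4, NOT infinite volume, NOT a mass gap, NOT Clay; the Yang–Mills mass gap is NOT proved.  Axioms standard.

References: T. Bałaban, CMP **99** (1985) 75–102 [Balaban1985RegularSpaces] (Thm 2 p.83).
-/

set_option autoImplicit false

noncomputable section

namespace Summit.QuantumFields.YangMills.Theorems.FluctuationComparisonRegPrIntLS2BetaSlowTwoFaceConeCentre

open scoped Real
open Literature.MathematicalPhysics.QuantumLattice (su2Quat)
open Literature.MathematicalPhysics.QuantumFieldTheory.Balaban1983to89
open T4CubeChartGnomonic (SU2)
open T4ExpWindowSmallField (logVec)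
open Summit.QuantumFields.YangMills.Theorems.FluctuationComparisonRegPrIntLS2BetaSlowDataNets (exists_patch_of_grid)
open Summit.QuantumFields.YangMills.Theorems.FluctuationComparisonRegPrIntLS2BetaAntipodalConeCentre (exists_coneCentre_of_patched)

/-- The cardinality of the two-faces index type `(Fin A × Fin B) ⊕ (Fin A × Fin B)`, in `ℝ`. [folklore] -/
theorem card_twoFaces (A B : ℕ) :
    (Fintype.card ((Fin A × Fin B) ⊕ (Fin A × Fin B)) : ℝ) = ((2 * (A * B) : ℕ) : ℝ) := by
  have h : Fintype.card ((Fin A × Fin B) ⊕ (Fin A × Fin B)) = 2 * (A * B) := by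
    simp only [Fintype.card_sum, Fintype.card_prod, Fintype.card_fin]; ring
  rw [h]

/-- ★★ **A CONE CENTRE FOR TWO SLOW FACES**: data `ψ` on the two `α`-faces `{i = 0}`, `{i = nα}` of the box `{0..nα} × {0..nβ} × {0..nγ}` with per-bond
oscillation `dist1 ≤ δ` along the `β`- and `γ`-bonds lying in those faces, a subsampling step `m ≥ 1` with `(π∕2)·2(m−1)·δ ≤ r∕2`, and the packing count
`2·(nβ∕m+1)(nγ∕m+1)·(2∕(3π))(3r∕2)³ < 1` admit ONE centre `a` with every face datum inside the cap `‖logVec (a⁻¹·ψ (i,k,l))‖ ≤ π − r` — no connection between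
the two faces is needed (packing, not paths).  The two-face twin of ✓`exists_tubeCentre`. [cite: Balaban1985RegularSpaces, Thm 2 p.83] -/
theorem exists_twoFaceCentre (nα nβ nγ m : ℕ) (hm : 1 ≤ m) (ψ : ℕ × ℕ × ℕ → SU2) {δ r : ℝ} (hδ : 0 ≤ δ) (hr0 : 0 ≤ r) (hrπ : 3 * r / 2 ≤ π)
    (hB : ∀ i k l, (i = 0 ∨ i = nα) → k + 1 ≤ nβ → l ≤ nγ → dist1 (ψ (i, k, l) * (ψ (i, k + 1, l))⁻¹) ≤ δ)
    (hC : ∀ i k l, (i = 0 ∨ i = nα) → k ≤ nβ → l + 1 ≤ nγ → dist1 (ψ (i, k, l) * (ψ (i, k, l + 1))⁻¹) ≤ δ)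
    (hrad : π / 2 * (((2 * (m - 1) : ℕ) : ℝ) * δ) ≤ r / 2)
    (hcard : ((2 * ((nβ / m + 1) * (nγ / m + 1)) : ℕ) : ℝ) * (2 / (3 * π) * (3 * r / 2) ^ 3) < 1) :
    ∃ a : SU2, ∀ i k l, (i = 0 ∨ i = nα) → k ≤ nβ → l ≤ nγ →
      ‖logVec (su2Quat (a⁻¹ * ψ (i, k, l)))‖ ≤ π - r := by
  -- the two faces as slow grids, subsampled every `m` steps in both directions
  have hF0 := exists_patch_of_grid (fun k l => ψ (0, k, l)) nβ nγ hδ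
    (fun k l hk hl => hB 0 k l (Or.inl rfl) hk hl) (fun k l hk hl => hC 0 k l (Or.inl rfl) hk hl) m hm
  have hF1 := exists_patch_of_grid (fun k l => ψ (nα, k, l)) nβ nγ hδ
    (fun k l hk hl => hB nα k l (Or.inr rfl) hk hl) (fun k l hk hl => hC nα k l (Or.inr rfl) hk hl) m hm
  obtain ⟨a, ha⟩ := exists_coneCentre_of_patched
    (ι := (Fin (nβ / m + 1) × Fin (nγ / m + 1)) ⊕ (Fin (nβ / m + 1) × Fin (nγ / m + 1)))
    (Sum.elim (fun q => ψ (0, m * (q.1 : ℕ), m * (q.2 : ℕ))) (fun q => ψ (nα, m * (q.1 : ℕ), m * (q.2 : ℕ))))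
    (Sum.elim (fun p : Fin (nβ + 1) × Fin (nγ + 1) => ψ (0, (p.1 : ℕ), (p.2 : ℕ)))
      (fun p : Fin (nβ + 1) × Fin (nγ + 1) => ψ (nα, (p.1 : ℕ), (p.2 : ℕ))))
    hr0 hrπ
    (by
      rintro (p | p)
      · obtain ⟨q, hq⟩ := hF0 p
        exact ⟨Sum.inl q, by simpa using hq.trans hrad⟩
      · obtain ⟨q, hq⟩ := hF1 p
        exact ⟨Sum.inr q, by simpa using hq.trans hrad⟩)
    (by rw [card_twoFaces]; exact hcard)
  refine ⟨a, fun i k l hi hk hl => ?_⟩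
  rcases hi with h | h
  · have h1 := ha (Sum.inl (⟨k, Nat.lt_succ_of_le hk⟩, ⟨l, Nat.lt_succ_of_le hl⟩))
    rw [h]; simpa using h1
  · have h1 := ha (Sum.inr (⟨k, Nat.lt_succ_of_le hk⟩, ⟨l, Nat.lt_succ_of_le hl⟩))
    rw [h]; simpa using h1

end Summit.QuantumFields.YangMills.Theorems.FluctuationComparisonRegPrIntLS2BetaSlowTwoFaceConeCentre

end
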